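import Summits.QuantumFields.YangMills.Theorems.ColdStartUniversalityLatticeLangevinHeatKernelMoments
import Literature.MathematicalPhysics.QuantumLattice.HeatKernelGroup
import HarnessLib

/-!
# Route `ColdStartUniversality` (fixed-cut-off package, `β' = 0`): the SU(2) character series IS a group heat kernel — an
# INHABITANT of `Literature.MathematicalPhysics.QuantumLattice.IsGroupHeatKernel` for `G = SU(2)`

Helper file (seat `ym-line-csu-p1`, g12, free hands).  The tree's hypothesis structure `IsGroupHeatKernel p` (Hunt / Stein / Lévy:
jointly continuous, non-negative, normalised, convolution semigroup, central, symmetric, approximate identity at `t → 0⁺`, no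
jumps) had no `SU(N)` inhabitant (cf. the `SusceptibilityToPoincare` line `rg_variance_cascade`).  For `SU(2)` the character series
`h_t(U) = Σ (n+1) e^{-n(n+2)t/2} χ_n(U)` of the `ColdStartUniversality` fixed-cut-off package satisfies all eight fields:

* ★★ `isGroupHeatKernel_heatKernelSU2` — joint continuity (locally uniform convergence), `h ≥ 0` (`heatKernelSU2_nonneg`),
  `∫ h_t = 1`, the semigroup law (`heatKernelSU2_semigroup`), centrality and symmetry (class function, `χ_n(U⁻¹) = χ_n(U)`),
  the approximate identity and the no-jump condition — both from the second moment `∫ (1 − Re tr/2)² h_t ≤ 17 t²`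
  (`…HeatKernelMoments`) and the trace-ball neighbourhood basis of `1`.

So every `IsGroupHeatKernel`-consequence in `Literature…QuantumLattice.HeatKernelGroup*` (heat-kernel lattice actions, `YM₂` loop
values, …) is available for `SU(2)` with this explicit kernel.  THEOREMS ONLY, [folklore]; RECORD-rung R3 plumbing; no crux, rung or
summit is proved here; the Yang–Mills mass gap is NOT proved.
-/

set_option autoImplicit false

noncomputable section

namespace Summit.QuantumFields.YangMills.Theorems.ColdStartUniversality

open MeasureTheory Finset Filter Topology
open scoped BigOperators Topology Matrix
open Literature.MathematicalPhysics.QuantumFieldTheory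
open Literature.MathematicalPhysics.QuantumFieldTheory.Tomboulis2007 (su2Char)
open Literature.Analysis.SpecialFunctions (gegenbauerSum)

/-- `∫ h_t dV = 1`. [folklore] -/
theorem integral_heatKernelSU2_eq_one {t : ℝ} (ht : 0 < t) :
    ∫ V, (∑' n : ℕ, ((n : ℝ) + 1) * Real.exp (-((n : ℝ) * ((n : ℝ) + 2) / 2) * t) * su2Char n V)
      ∂(haarProbability (Matrix.specialUnitaryGroup (Fin 2) ℂ)) = 1 := by
  have h := integral_su2Char_mul_heatKernelSU2_one ht 0
  simp only [su2Char_zero_apply, one_mul, Nat.cast_zero, zero_mul, zero_div, neg_zero, Real.exp_zero, zero_add] at h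
  exact h

/-- **Joint continuity** of `(t, U) ↦ h_t(U)` on `(t₀, ∞) × SU(2)` for every `t₀ > 0` (uniform convergence). [folklore] -/
theorem continuousOn_heatKernelSU2_prod {t₀ : ℝ} (ht₀ : 0 < t₀) :
    ContinuousOn (fun q : ℝ × Matrix.specialUnitaryGroup (Fin 2) ℂ =>
      ∑' n : ℕ, ((n : ℝ) + 1) * Real.exp (-((n : ℝ) * ((n : ℝ) + 2) / 2) * q.1) * su2Char n q.2) (Set.Ioi t₀ ×ˢ Set.univ) := by
  refine continuousOn_tsum (u := fun n : ℕ => ((n : ℝ) + 1) ^ 2 * Real.exp (-((n : ℝ) * ((n : ℝ) + 2) / 2) * t₀))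
    (fun n => ?_) (summable_heatKernelSU2_majorant ht₀) (fun n q hq => ?_)
  · exact ((continuous_const.mul (Real.continuous_exp.comp (continuous_const.mul continuous_fst))).mul
      ((continuous_su2Char_apply n).comp continuous_snd)).continuousOn
  · obtain ⟨hq1, -⟩ := hq
    have hq1' : t₀ < q.1 := hq1
    refine (norm_heatKernelSU2_term_le q.1 n q.2).trans ?_
    refine mul_le_mul_of_nonneg_left (Real.exp_le_exp.2 ?_) (by positivity)
    have hn : (0 : ℝ) ≤ (n : ℝ) * ((n : ℝ) + 2) / 2 := by positivity
    nlinarith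

/-- ★★ **The SU(2) character series is a group heat kernel** in the sense of `Literature…QuantumLattice.IsGroupHeatKernel`:
`(t, U) ↦ Σ (n+1) e^{-n(n+2)t/2} χ_n(U)` is a jointly continuous, non-negative, normalised, central, symmetric convolution
semigroup on `SU(2)` which is an approximate identity without jumps as `t → 0⁺`. [folklore] -/
theorem isGroupHeatKernel_heatKernelSU2 :
    Literature.MathematicalPhysics.QuantumLattice.IsGroupHeatKernel
      (fun (t : ℝ) (U : Matrix.specialUnitaryGroup (Fin 2) ℂ) =>
        ∑' n : ℕ, ((n : ℝ) + 1) * Real.exp (-((n : ℝ) * ((n : ℝ) + 2) / 2) * t) * su2Char n U) := by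
  haveI : IsProbabilityMeasure (haarProbability (Matrix.specialUnitaryGroup (Fin 2) ℂ)) := inferInstance
  refine ⟨?_, fun t ht g => heatKernelSU2_nonneg ht g, fun t ht => integral_heatKernelSU2_eq_one ht,
    fun s t hs ht g => (heatKernelSU2_semigroup hs ht g).symm, fun t _ g h => ?_, fun t _ g => ?_, fun f => ?_,
    fun U hU => ?_⟩
  · -- joint continuity on `(0, ∞) × G`
    intro q hq
    obtain ⟨hq1, -⟩ := hq
    have hq1' : 0 < q.1 := hq1
    have hmem : q ∈ Set.Ioi (q.1 / 2) ×ˢ (Set.univ : Set (Matrix.specialUnitaryGroup (Fin 2) ℂ)) :=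
      ⟨by show q.1 / 2 < q.1; linarith, Set.mem_univ _⟩
    have h := (continuousOn_heatKernelSU2_prod (t₀ := q.1 / 2) (by positivity)).continuousAt
      ((isOpen_Ioi.prod isOpen_univ).mem_nhds hmem)
    exact h.continuousWithinAt
  · -- central
    refine tsum_congr fun n => ?_
    rw [su2Char_mul_comm n (h * g) h⁻¹, inv_mul_cancel_left]
  · -- symmetric
    exact tsum_congr fun n => by rw [su2Char_inv]
  · -- approximate identity
    rw [Metric.tendsto_nhdsWithin_nhds]
    intro ε hε
    have hUn : {g : Matrix.specialUnitaryGroup (Fin 2) ℂ | dist (f g) (f 1) < ε / 2} ∈ 𝓝 (1 : Matrix.specialUnitaryGroup (Fin 2) ℂ) :=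
      (isOpen_lt (f.continuous.dist continuous_const) continuous_const).mem_nhds (by simp [hε])
    obtain ⟨ρ, hρ, hball⟩ := exists_lt_trace_subset_of_mem_nhds hUn
    set Mf : ℝ := ‖f‖ with hMf
    have hMf0 : 0 ≤ Mf := norm_nonneg _
    have hfb : ∀ g, |f g| ≤ Mf := fun g => by rw [← Real.norm_eq_abs]; exact f.norm_coe_le_norm g
    set δ : ℝ := min (1 / 4) (ε * ρ ^ 2 / (4 * (34 * Mf + 1))) with hδ
    have hδ0 : 0 < δ := lt_min (by norm_num) (by positivity)
    refine ⟨δ, hδ0, fun t ht hdist => ?_⟩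
    have ht0 : 0 < t := ht
    have htδ : t < δ := by
      rw [Real.dist_eq, sub_zero, abs_of_pos ht0] at hdist; exact hdist
    have ht4 : t ≤ 1 / 4 := (htδ.le.trans (min_le_left _ _))
    have htε : t < ε * ρ ^ 2 / (4 * (34 * Mf + 1)) := lt_of_lt_of_le htδ (min_le_right _ _)
    -- pointwise bound `|f g − f 1| h ≤ (ε/2 + (2Mf/ρ²)(1−x)²) h`
    set hk : Matrix.specialUnitaryGroup (Fin 2) ℂ → ℝ := fun V =>
      ∑' n : ℕ, ((n : ℝ) + 1) * Real.exp (-((n : ℝ) * ((n : ℝ) + 2) / 2) * t) * su2Char n V with hhk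
    have hk0 : ∀ V, 0 ≤ hk V := fun V => heatKernelSU2_nonneg ht0 V
    have hpt : ∀ g : Matrix.specialUnitaryGroup (Fin 2) ℂ, ‖(f g - f 1) * hk g‖ ≤
        (ε / 2 + 2 * Mf / ρ ^ 2 * (1 - ((g : Matrix (Fin 2) (Fin 2) ℂ)).trace.re / 2) ^ 2) * hk g := by
      intro g
      rw [norm_mul, Real.norm_eq_abs, Real.norm_eq_abs, abs_of_nonneg (hk0 g)]
      refine mul_le_mul_of_nonneg_right ?_ (hk0 g)
      by_cases hg : 1 - ((g : Matrix (Fin 2) (Fin 2) ℂ)).trace.re / 2 < ρ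
      · have h1 : dist (f g) (f 1) < ε / 2 := hball g hg
        rw [Real.dist_eq] at h1
        have h2 : 0 ≤ 2 * Mf / ρ ^ 2 * (1 - ((g : Matrix (Fin 2) (Fin 2) ℂ)).trace.re / 2) ^ 2 := by positivity
        linarith
      · rw [not_lt] at hg
        have h1 : |f g - f 1| ≤ 2 * Mf := by
          have := abs_sub (f g) (f 1); linarith [hfb g, hfb 1]
        have h2 : 2 * Mf ≤ 2 * Mf / ρ ^ 2 * (1 - ((g : Matrix (Fin 2) (Fin 2) ℂ)).trace.re / 2) ^ 2 := by
          rw [div_mul_eq_mul_div, le_div_iff₀ (by positivity)]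
          exact mul_le_mul_of_nonneg_left (pow_le_pow_left₀ hρ.le hg 2) (by positivity)
        linarith
    -- integrability
    have hif : Integrable (fun g => (f g - f 1) * hk g) (haarProbability (Matrix.specialUnitaryGroup (Fin 2) ℂ)) :=
      integrable_mul_heatKernelSU2 ht0 (f.continuous.sub continuous_const) (B := 2 * Mf)
        (fun g => by have := abs_sub (f g) (f 1); linarith [hfb g, hfb 1])
    have hx2b : ∀ V : Matrix.specialUnitaryGroup (Fin 2) ℂ,
        |ε / 2 + 2 * Mf / ρ ^ 2 * (1 - ((V : Matrix (Fin 2) (Fin 2) ℂ)).trace.re / 2) ^ 2| ≤ ε / 2 + 2 * Mf / ρ ^ 2 * 4 := by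
      intro V
      have hm := re_trace_div_two_mem V
      rw [abs_of_nonneg (by positivity)]
      have : (1 - ((V : Matrix (Fin 2) (Fin 2) ℂ)).trace.re / 2) ^ 2 ≤ 4 := by nlinarith [hm.1, hm.2]
      nlinarith [div_nonneg (by positivity : (0 : ℝ) ≤ 2 * Mf) (sq_nonneg ρ)]
    have hiG : Integrable (fun g : Matrix.specialUnitaryGroup (Fin 2) ℂ =>
        (ε / 2 + 2 * Mf / ρ ^ 2 * (1 - ((g : Matrix (Fin 2) (Fin 2) ℂ)).trace.re / 2) ^ 2) * hk g)
        (haarProbability (Matrix.specialUnitaryGroup (Fin 2) ℂ)) :=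
      integrable_mul_heatKernelSU2 ht0 (continuous_const.add (continuous_const.mul
        ((continuous_const.sub continuous_re_trace_div_two).pow 2))) hx2b
    have hi1 : Integrable hk (haarProbability (Matrix.specialUnitaryGroup (Fin 2) ℂ)) := by
      have := integrable_mul_heatKernelSU2 ht0 (φ := fun _ => (1 : ℝ)) continuous_const (B := 1) (fun _ => by simp)
      simpa [hhk] using this
    have hi2 : Integrable (fun g : Matrix.specialUnitaryGroup (Fin 2) ℂ =>
        (1 - ((g : Matrix (Fin 2) (Fin 2) ℂ)).trace.re / 2) ^ 2 * hk g) (haarProbability (Matrix.specialUnitaryGroup (Fin 2) ℂ)) :=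
      integrable_mul_heatKernelSU2 ht0 ((continuous_const.sub continuous_re_trace_div_two).pow 2) (B := 4) (fun V => by
        have hm := re_trace_div_two_mem V
        rw [abs_of_nonneg (by positivity)]; nlinarith [hm.1, hm.2])
    -- `∫ f h − f 1 = ∫ (f − f 1) h`
    have hone : ∫ g, hk g ∂(haarProbability (Matrix.specialUnitaryGroup (Fin 2) ℂ)) = 1 := integral_heatKernelSU2_eq_one ht0
    have hdiff : (∫ g, f g * hk g ∂(haarProbability (Matrix.specialUnitaryGroup (Fin 2) ℂ))) - f 1 =
        ∫ g, (f g - f 1) * hk g ∂(haarProbability (Matrix.specialUnitaryGroup (Fin 2) ℂ)) := by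
      have hif1 : Integrable (fun g => f g * hk g) (haarProbability (Matrix.specialUnitaryGroup (Fin 2) ℂ)) :=
        integrable_mul_heatKernelSU2 ht0 f.continuous hfb
      have e : (fun g => (f g - f 1) * hk g) = fun g => f g * hk g - f 1 * hk g := funext fun g => by ring
      rw [e, integral_sub hif1 (hi1.const_mul _), integral_const_mul, hone, mul_one]
    rw [Real.dist_eq, hdiff]
    have hM2 := integral_one_sub_sq_mul_heatKernelSU2_le ht0 ht4
    calc |∫ g, (f g - f 1) * hk g ∂(haarProbability (Matrix.specialUnitaryGroup (Fin 2) ℂ))|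
        ≤ ∫ g, (ε / 2 + 2 * Mf / ρ ^ 2 * (1 - ((g : Matrix (Fin 2) (Fin 2) ℂ)).trace.re / 2) ^ 2) * hk g
            ∂(haarProbability (Matrix.specialUnitaryGroup (Fin 2) ℂ)) := by
          rw [← Real.norm_eq_abs]
          exact norm_integral_le_of_norm_le hiG (Eventually.of_forall hpt)
      _ = ε / 2 + 2 * Mf / ρ ^ 2 * ∫ g, (1 - ((g : Matrix (Fin 2) (Fin 2) ℂ)).trace.re / 2) ^ 2 * hk g
            ∂(haarProbability (Matrix.specialUnitaryGroup (Fin 2) ℂ)) := by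
          have e : (fun g : Matrix.specialUnitaryGroup (Fin 2) ℂ =>
              (ε / 2 + 2 * Mf / ρ ^ 2 * (1 - ((g : Matrix (Fin 2) (Fin 2) ℂ)).trace.re / 2) ^ 2) * hk g) =
              fun g => (ε / 2) * hk g + (2 * Mf / ρ ^ 2) * ((1 - ((g : Matrix (Fin 2) (Fin 2) ℂ)).trace.re / 2) ^ 2 * hk g) :=
            funext fun g => by ring
          rw [e, integral_add (hi1.const_mul _) (hi2.const_mul _), integral_const_mul, integral_const_mul, hone, mul_one]
      _ ≤ ε / 2 + 2 * Mf / ρ ^ 2 * (17 * t ^ 2) := by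
          have := mul_le_mul_of_nonneg_left hM2 (by positivity : (0 : ℝ) ≤ 2 * Mf / ρ ^ 2)
          linarith
      _ < ε := by
          -- `34 Mf t² / ρ² ≤ (34 Mf + 1) t / ρ² < ε/4`
          have hρ2 : 0 < ρ ^ 2 := by positivity
          have h1 : 2 * Mf / ρ ^ 2 * (17 * t ^ 2) ≤ (34 * Mf + 1) * t / ρ ^ 2 := by
            rw [div_mul_eq_mul_div, div_le_div_iff_of_pos_right hρ2]
            nlinarith [mul_nonneg hMf0 ht0.le]
          have h2 : (34 * Mf + 1) * t / ρ ^ 2 < ε / 4 := by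
            rw [div_lt_iff₀ hρ2]
            have := (lt_div_iff₀ (by positivity : (0 : ℝ) < 4 * (34 * Mf + 1))).1 htε
            nlinarith
          linarith
  · -- no jumps
    obtain ⟨ρ, hρ, hball⟩ := exists_lt_trace_subset_of_mem_nhds hU
    have hS : ∀ V ∈ Uᶜ, ρ ≤ 1 - ((V : Matrix (Fin 2) (Fin 2) ℂ)).trace.re / 2 := by
      intro V hV
      by_contra h
      exact hV (hball V (lt_of_not_ge h))
    -- squeeze between `0` and `17 t / ρ²` on `(0, 1/4]`
    have hev : ∀ᶠ t in 𝓝[>] (0 : ℝ), 0 < t ∧ t ≤ 1 / 4 := by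
      have h1 : ∀ᶠ t in 𝓝[>] (0 : ℝ), 0 < t := eventually_mem_nhdsWithin
      have h2 : ∀ᶠ t in 𝓝[>] (0 : ℝ), t ≤ 1 / 4 :=
        mem_nhdsWithin_of_mem_nhds (Iic_mem_nhds (by norm_num : (0 : ℝ) < 1 / 4))
      exact h1.and h2
    have hupper : Tendsto (fun t : ℝ => 17 * t / ρ ^ 2) (𝓝[>] (0 : ℝ)) (𝓝 0) := by
      have hc : Continuous fun t : ℝ => 17 * t / ρ ^ 2 := (continuous_const.mul continuous_id).div_const _
      have := hc.tendsto 0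
      simp only [mul_zero, zero_div] at this
      exact tendsto_nhdsWithin_of_tendsto_nhds this
    refine tendsto_of_tendsto_of_tendsto_of_le_of_le' tendsto_const_nhds hupper ?_ ?_
    · filter_upwards [hev] with t ht
      exact mul_nonneg (inv_nonneg.2 ht.1.le) (integral_nonneg fun V => heatKernelSU2_nonneg ht.1 V)
    · filter_upwards [hev] with t ht
      have htail := setIntegral_heatKernelSU2_le_div ht.1 hρ hS
      have hM2 := integral_one_sub_sq_mul_heatKernelSU2_le ht.1 ht.2
      have hρ2 : 0 < ρ ^ 2 := by positivity
      calc t⁻¹ * ∫ V in Uᶜ, (∑' n : ℕ, ((n : ℝ) + 1) * Real.exp (-((n : ℝ) * ((n : ℝ) + 2) / 2) * t) * su2Char n V)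
            ∂(haarProbability (Matrix.specialUnitaryGroup (Fin 2) ℂ))
          ≤ t⁻¹ * (17 * t ^ 2 / ρ ^ 2) := by
            refine mul_le_mul_of_nonneg_left (htail.trans ?_) (inv_nonneg.2 ht.1.le)
            exact div_le_div_of_nonneg_right hM2 hρ2.le
        _ = 17 * t / ρ ^ 2 := by field_simp

end Summit.QuantumFields.YangMills.Theorems.ColdStartUniversality

end
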